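import Summits.QuantumFields.BalabanUV.Beta.GAN24.DirichletVertexLocalW
import Summits.QuantumFields.BalabanUV.Beta.GAN24.DirichletVertexPiece
import Summits.QuantumFields.BalabanUV.Beta.GAN24.DirichletVertexHessian

/-!
# `BalabanUV.Beta.GAN24.DirichletVertexDom` — binder row G-an2-4 / (CONV-C), road P2 PART IV, leaf L14 (the torus transfer), FILE C5b-2:
# THE WINDOW CENSUS AND THE POINTWISE DOMINATION OF A WEIGHT ON `Ω` BY THE WINDOW WEIGHTS (unit b2b-balaban-gan24-p2, gen 27, v1)

HONEST FRAMING (cell contract, verbatim): «discharging `BetaPertH` makes Bałaban's UV stability UNCONDITIONAL — a real constructive-QFT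
result; it is NOT the continuum limit and NOT the Clay problem.»  SUPPLIER module under the T⁴-DAG sub-row `T4-U1a.S-NE2-D1-DIRICHLET°`
(owner wording R24 «the full rate L⁻¹ beyond boxes OPEN»).  Binder (A′) of the weighted socket (p234489) asks for a weighted interior Hessian
bound with a weight `g` that is `O(distance/n)` near re-entrant vertices and `O(1)` elsewhere.  The per-window bounds are in the tree
(`DirichletVertexHessian` p244740: weight `hessW_v` on dyadic neighbourhoods of re-entrant vertices; `DirichletVertexLocalW` p246354: weight
`plainWT` on product windows; `DirichletVertexPiece` p245486: weight `pieceW` on isolated quadrant pieces).  THIS FILE fixes the CENSUS —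
windows centred at `n·b + q·k`, `k ∈ {0,…,3}²`, `q = ⌊n/4⌋`, half-width `q − 1`, plateau `P = q − 3 − 2L`, `L = ⌊n/64⌋`, identity
orientation — and proves the POINTWISE DOMINATION on `Ω`: `g(x) ≤ C_g·Σ_{v∈V} hessW_v(x) + g_max·(W_P(x) + W_T(x) + W_I(x))` for every
`x ∈ Ω`, every family `V ⊇` re-entrant vertices and every `g` with `0 ≤ g ≤ g_max`, `g(emb σ b i j) ≤ C_g·ρ(i,j)/n` off the quadrant of
every `(σ,b) ∈ V` (`ρ ≤ 2^{J+3}`, `q + 6 ≤ 2^{J+4}`): §1 census parameters and window families `WP`/`WT`/`WI`/`WH` with single-term lower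
bounds; §2 **`locate`** (every site is `emb TT b (m₀ + q·k₀) (m₁ + q·k₁)`, `k_ν ≤ 3`, `2·tIdx m_ν ≤ q + 6`, `n ≥ 64`); §3 **`dom_pointwise`**
(product / isolated / re-entrant trichotomy of `DirichletVertexLocate.exists_reentrant`).  The summed binder follows in `DirichletVertexDomSum`.
[folklore] finite bookkeeping on the tree's typed torus; 0 sorry.

ABSOLUTE RULE (cell, verbatim): «No internally-minted statement may enter as a cited fact. Every hypothesis is either kernel-proved in
this package or a verbatim quotation of a PUBLISHED theorem with page reference. The manuscript(s) under audit are NOT citable for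
their own disputed steps — they are the thing under adjudication; programme-internal (2001/route/tribunal) claims are never citable.»
Nothing printed is a hypothesis; no estimate of any Bałaban object is made here.  NOT CLAIMED: the summed (A′), (Φ)/(Φ′), the END
(p234489 stays CONDITIONAL); NOT NE2, (CONV-C), `BetaPertH`, continuum, Clay.  «not in print; our proof attempt».  HONEST DEPENDENCY:
continuum YM on T⁴ ⇐ BetaPertH ∧ nine spine estimates (0/9 proved); BetaPertH ⇐ (D1) ∧ (D4) ∧ CAP+tail; G-an2-4 gates asym, D1 and NE2/3/4.
-/

noncomputable section

open scoped BigOperators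
open Finset

namespace Summit.QuantumFields.BalabanUV.Beta.GAN24.DirichletVertexDom

open Literature.MathematicalPhysics.QuantumFieldTheory.Balaban1983to89.B5Prop11Plancherel (Tor fine unitVec)
open Literature.MathematicalPhysics.QuantumFieldTheory.Balaban1983to89.B5Blocks16 (blockOf)
open Summit.QuantumFields.BalabanUV.Beta.GAN24.DirichletBoxTrace (blockReg)
open DirichletRingCutoff (tIdx one_le_tIdx)
open DirichletRingHessianIdentity (offQ)
open DirichletRingHessianWindow (rho)
open DirichletRingHessianLocal (indW)
open DirichletRingLayerCake (wJ)
open DirichletVertexChart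
open DirichletVertexHessian (hessW hessW_nonneg)
open DirichletVertexLocalT (WprodT plainWT plainWT_nonneg)
open DirichletVertexPiece (Quad IsolatedAt pieceW pieceW_nonneg)
open DirichletVertexLocate (TT TT_apply crd_TT emb_TT_blockOf emb_TT_add_unitVec crd_crd tIdx_crd crd_nonneg_iff emb_crd
  pat_eq reentrantAt_iff_TT IsProdAt exists_reentrant rnd rnd_le_four tIdx_sub_rnd_le tIdx_sub_n_le)
open DirichletVertexLocalW (Awin Bwin hW_corner hW_both hW_fst hW_snd blockReg_emb_TT_iff)

variable (n : ℕ) [NeZero n] (M : Fin 2 → ℕ) [hM : ∀ μ, NeZero (M μ)]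

/-! ## §1 The census and the window families -/

/-- the local-`H²` scale `L = ⌊n/64⌋` of all unweighted windows. [folklore] -/
def Ln : ℕ := n / 64

/-- the slack `c = q − 2 − 4L` (so that the half-width `4L + c + 1` is `q − 1`). [folklore] -/
def cn : ℕ := n / 4 - 2 - 4 * (n / 64)

/-- the plateau `P = 2L + c − 1 = q − 3 − 2L`. [folklore] -/
def Pn : ℕ := 2 * Ln n + cn n - 1

omit [NeZero n] in
/-- the census arithmetic (`n ≥ 64`): `4L + c + 2 = q`, `2P + 6 + 4L = 2q`, `1 ≤ L`, `q + 6 ≤ 2P`, `P + 1 ≤ q`, `4q ≤ n < 4q + 4`. [folklore] -/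
theorem census_arith (hn : 64 ≤ n) :
    4 * Ln n + cn n + 2 = n / 4 ∧ 2 * Pn n + 6 + 4 * Ln n = 2 * (n / 4) ∧ 1 ≤ Ln n ∧ n / 4 + 6 ≤ 2 * Pn n ∧ Pn n + 1 ≤ n / 4
      ∧ 4 * (n / 4) ≤ n ∧ n < 4 * (n / 4) + 4 := by
  simp only [Ln, cn, Pn]; omega

variable (S : Tor M → Prop) [DecidablePred S]

/-- decidability of isolation (classical; used only to filter the finite family of pieces). [folklore] -/
instance decIsolatedAt (S : Tor M → Prop) (σ : Fin 2 → Bool) (b : Tor M) (a y : Bool) : Decidable (IsolatedAt M S σ b a y) :=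
  Classical.dec _

/-- **W_P**: the corner windows (`τ = 0`) of the vertices with a PRODUCT star. [folklore] -/
def WP (x : Tor (fine n M)) : ℝ :=
  ∑ b ∈ univ.filter (fun b : Tor M => IsProdAt M S b), plainWT n M (TT, b) (Awin M S b 0 0) (Bwin M S b 0 0) 0 0 (Pn n) x

/-- the translated grid indices `k ∈ {0,…,3}² ∖ {(0,0)}`. [folklore] -/
def Kgrid : Finset (ℕ × ℕ) := ((range 4) ×ˢ (range 4)).erase (0, 0)

/-- **W_T**: the translated windows (centres `n·b + q·k`, `k ≠ 0`), for EVERY vertex `b`. [folklore] -/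
def WT (x : Tor (fine n M)) : ℝ :=
  ∑ b : Tor M, ∑ k ∈ Kgrid, plainWT n M (TT, b) (Awin M S b k.1 k.2) (Bwin M S b k.1 k.2)
    (((n / 4 : ℕ) : ℤ) * k.1) (((n / 4 : ℕ) : ℤ) * k.2) (Pn n) x

/-- **W_I**: the isolated quadrant pieces of every vertex star. [folklore] -/
def WI (x : Tor (fine n M)) : ℝ :=
  ∑ b : Tor M, ∑ ay ∈ (univ : Finset (Bool × Bool)).filter (fun ay => IsolatedAt M S TT b ay.1 ay.2),
    pieceW n M (TT, b) ay.1 ay.2 (Pn n) x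

/-- **W_H**: the dyadic distance weights of the family `V`. [folklore] -/
def WH (V : Finset ((Fin 2 → Bool) × Tor M)) (J : ℕ) (x : Tor (fine n M)) : ℝ := ∑ v ∈ V, hessW n M v (n - 1) J x

omit [NeZero n] in
/-- `0 ≤ W_P`. [folklore] -/
theorem WP_nonneg (x : Tor (fine n M)) : 0 ≤ WP n M S x := sum_nonneg fun _ _ => plainWT_nonneg n M _ _ _ _ _ _ _
omit [NeZero n] in
/-- `0 ≤ W_T`. [folklore] -/
theorem WT_nonneg (x : Tor (fine n M)) : 0 ≤ WT n M S x := sum_nonneg fun _ _ => sum_nonneg fun _ _ => plainWT_nonneg n M _ _ _ _ _ _ _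
omit [NeZero n] [DecidablePred S] in
/-- `0 ≤ W_I`. [folklore] -/
theorem WI_nonneg (x : Tor (fine n M)) : 0 ≤ WI n M S x := sum_nonneg fun _ _ => sum_nonneg fun _ _ => pieceW_nonneg n M _ _ _ _ _
omit [NeZero n] hM in
/-- `0 ≤ W_H`. [folklore] -/
theorem WH_nonneg (V : Finset ((Fin 2 → Bool) × Tor M)) (J : ℕ) (x : Tor (fine n M)) : 0 ≤ WH n M V J x :=
  sum_nonneg fun v _ => hessW_nonneg n M v _ _ x

omit [NeZero n] in
/-- a corner window of a product star is a term of `W_P`. [folklore] -/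
theorem plainWT_le_WP {b : Tor M} (hb : IsProdAt M S b) (x : Tor (fine n M)) :
    plainWT n M (TT, b) (Awin M S b 0 0) (Bwin M S b 0 0) 0 0 (Pn n) x ≤ WP n M S x :=
  single_le_sum (f := fun b' => plainWT n M (TT, b') (Awin M S b' 0 0) (Bwin M S b' 0 0) 0 0 (Pn n) x)
    (fun _ _ => plainWT_nonneg n M _ _ _ _ _ _ _) (mem_filter.mpr ⟨mem_univ _, hb⟩)

omit [NeZero n] in
/-- a translated window is a term of `W_T`. [folklore] -/
theorem plainWT_le_WT (b : Tor M) {k : ℕ × ℕ} (hk : k ∈ Kgrid) (x : Tor (fine n M)) :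
    plainWT n M (TT, b) (Awin M S b k.1 k.2) (Bwin M S b k.1 k.2) (((n / 4 : ℕ) : ℤ) * k.1) (((n / 4 : ℕ) : ℤ) * k.2) (Pn n) x
      ≤ WT n M S x := by
  have h3 : plainWT n M (TT, b) (Awin M S b k.1 k.2) (Bwin M S b k.1 k.2) (((n / 4 : ℕ) : ℤ) * k.1) (((n / 4 : ℕ) : ℤ) * k.2) (Pn n) x
      ≤ ∑ k' ∈ Kgrid, plainWT n M (TT, b) (Awin M S b k'.1 k'.2) (Bwin M S b k'.1 k'.2)
          (((n / 4 : ℕ) : ℤ) * k'.1) (((n / 4 : ℕ) : ℤ) * k'.2) (Pn n) x :=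
    single_le_sum (f := fun k' : ℕ × ℕ => plainWT n M (TT, b) (Awin M S b k'.1 k'.2) (Bwin M S b k'.1 k'.2)
      (((n / 4 : ℕ) : ℤ) * k'.1) (((n / 4 : ℕ) : ℤ) * k'.2) (Pn n) x) (fun k' _ => plainWT_nonneg n M _ _ _ _ _ _ _) hk
  refine h3.trans ?_
  exact single_le_sum (f := fun b' => ∑ k' ∈ Kgrid, plainWT n M (TT, b') (Awin M S b' k'.1 k'.2) (Bwin M S b' k'.1 k'.2)
    (((n / 4 : ℕ) : ℤ) * k'.1) (((n / 4 : ℕ) : ℤ) * k'.2) (Pn n) x) (fun b' _ => sum_nonneg fun k' _ => plainWT_nonneg n M _ _ _ _ _ _ _)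
    (mem_univ b)

omit [NeZero n] [DecidablePred S] in
/-- an isolated piece is a term of `W_I`. [folklore] -/
theorem pieceW_le_WI (b : Tor M) {ay : Bool × Bool} (h : IsolatedAt M S TT b ay.1 ay.2) (x : Tor (fine n M)) :
    pieceW n M (TT, b) ay.1 ay.2 (Pn n) x ≤ WI n M S x := by
  have h3 : pieceW n M (TT, b) ay.1 ay.2 (Pn n) x
      ≤ ∑ ay' ∈ (univ : Finset (Bool × Bool)).filter (fun ay' => IsolatedAt M S TT b ay'.1 ay'.2), pieceW n M (TT, b) ay'.1 ay'.2 (Pn n) x :=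
    single_le_sum (f := fun ay' : Bool × Bool => pieceW n M (TT, b) ay'.1 ay'.2 (Pn n) x) (fun ay' _ => pieceW_nonneg n M _ _ _ _ _)
      (mem_filter.mpr ⟨mem_univ ay, h⟩)
  refine h3.trans ?_
  exact single_le_sum (f := fun b' => ∑ ay' ∈ (univ : Finset (Bool × Bool)).filter (fun ay' => IsolatedAt M S TT b' ay'.1 ay'.2),
    pieceW n M (TT, b') ay'.1 ay'.2 (Pn n) x) (fun b' _ => sum_nonneg fun ay' _ => pieceW_nonneg n M _ _ _ _ _) (mem_univ b)

omit [NeZero n] hM in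
/-- a dyadic weight of `v ∈ V` is a term of `W_H`. [folklore] -/
theorem hessW_le_WH {V : Finset ((Fin 2 → Bool) × Tor M)} {v : (Fin 2 → Bool) × Tor M} (hv : v ∈ V) (J : ℕ) (x : Tor (fine n M)) :
    hessW n M v (n - 1) J x ≤ WH n M V J x :=
  single_le_sum (f := fun v' => hessW n M v' (n - 1) J x) (fun v' _ => hessW_nonneg n M v' _ _ x) hv

omit [NeZero n] hM [DecidablePred S] in
/-- a pushed-forward weight dominates its value at any hit. [folklore] -/
theorem le_pushforward {A : ℕ} (φ : ℕ → ℕ → Tor (fine n M)) (w : ℕ → ℕ → ℝ) (hw : ∀ t s, 0 ≤ w t s) {x : Tor (fine n M)} {s t : ℕ}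
    (hs : s < A) (ht : t < A) (hx : x = φ t s) :
    w t s ≤ ∑ t' ∈ range A, ∑ s' ∈ range A, if x = φ t' s' then w t' s' else 0 := by
  set f : ℕ → ℕ → ℝ := fun t' s' => if x = φ t' s' then w t' s' else 0 with hf
  have h0 : ∀ t' s', 0 ≤ f t' s' := fun t' s' => by simp only [hf]; split_ifs; exacts [hw t' s', le_rfl]
  have hts : f t s = w t s := by simp only [hf]; exact if_pos hx
  rw [← hts]
  calc f t s ≤ ∑ s' ∈ range A, f t s' := single_le_sum (f := fun s' => f t s') (fun s' _ => h0 t s') (mem_range.mpr hs)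
    _ ≤ ∑ t' ∈ range A, ∑ s' ∈ range A, f t' s' :=
        single_le_sum (f := fun t' => ∑ s' ∈ range A, f t' s') (fun t' _ => sum_nonneg fun s' _ => h0 t' s') (mem_range.mpr ht)

omit [NeZero n] hM [DecidablePred S] in
/-- **the plateau indicator at a window site is at most the pushed-forward weight**. [folklore] -/
theorem le_plainWT (v : (Fin 2 → Bool) × Tor M) (A B : Bool → Prop) [DecidablePred A] [DecidablePred B] (τ₀ τ₁ : ℤ) (P : ℕ)
    {x : Tor (fine n M)} {s t : ℕ} (hs : s < 2 * P) (ht : t < 2 * P)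
    (hx : x = emb n M v.1 v.2 (-(P : ℤ) + s + τ₀) (-(P : ℤ) + t + τ₁)) :
    indW (WprodT A B τ₀ τ₁) (-(P : ℤ) + s) (-(P : ℤ) + t) ≤ plainWT n M v A B τ₀ τ₁ P x := by
  unfold plainWT
  exact le_pushforward n M (fun t' s' : ℕ => emb n M v.1 v.2 (-(P : ℤ) + s' + τ₀) (-(P : ℤ) + t' + τ₁))
    (fun t' s' : ℕ => indW (WprodT A B τ₀ τ₁) (-(P : ℤ) + s') (-(P : ℤ) + t')) (fun _ _ => (DirichletRingHessianLocal.indW_mem _ _ _).1)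
    hs ht hx

omit [NeZero n] hM [DecidablePred S] in
/-- the same for the piece weight. [folklore] -/
theorem le_pieceW (v : (Fin 2 → Bool) × Tor M) (a y : Bool) (P : ℕ) {x : Tor (fine n M)} {s t : ℕ} (hs : s < 2 * P) (ht : t < 2 * P)
    (hx : x = emb n M v.1 v.2 (-(P : ℤ) + s) (-(P : ℤ) + t)) :
    indW (Quad a y) (-(P : ℤ) + s) (-(P : ℤ) + t) ≤ pieceW n M v a y P x := by
  unfold pieceW
  exact le_pushforward n M (fun t' s' : ℕ => emb n M v.1 v.2 (-(P : ℤ) + s') (-(P : ℤ) + t'))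
    (fun t' s' : ℕ => indW (Quad a y) (-(P : ℤ) + s') (-(P : ℤ) + t')) (fun _ _ => (DirichletRingHessianLocal.indW_mem _ _ _).1) hs ht hx

omit [NeZero n] hM [DecidablePred S] in
/-- the same for the dyadic distance weight. [folklore] -/
theorem le_hessW (v : (Fin 2 → Bool) × Tor M) (K J : ℕ) {x : Tor (fine n M)} {s t : ℕ} (hs : s < 2 * K) (ht : t < 2 * K)
    (hx : x = emb n M v.1 v.2 (-(K : ℤ) + s) (-(K : ℤ) + t)) :
    offQ (-(K : ℤ) + s) (-(K : ℤ) + t) * wJ J (-(K : ℤ) + s) (-(K : ℤ) + t) / (n : ℝ) ≤ hessW n M v K J x := by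
  unfold hessW
  exact le_pushforward n M (fun t' s' : ℕ => emb n M v.1 v.2 (-(K : ℤ) + s') (-(K : ℤ) + t'))
    (fun t' s' : ℕ => offQ (-(K : ℤ) + s') (-(K : ℤ) + t') * wJ J (-(K : ℤ) + s') (-(K : ℤ) + t') / (n : ℝ))
    (fun _ _ => div_nonneg (mul_nonneg (DirichletRingHessianIdentity.offQ_nonneg _ _) (DirichletVertexHessian.wJ_nonneg _ _ _))
      (Nat.cast_nonneg _)) hs ht hx

/-! ## §2 Locating a site in the census -/

omit [NeZero n] [DecidablePred S] in
/-- shifting the base vertex by `[d₀]e₀ + [d₁]e₁` shifts the model coordinates by `−n·[d_ν]`. [folklore] -/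
theorem emb_TT_shift (B₀ : Tor M) (d₀ d₁ : Bool) (i j : ℤ) :
    emb n M TT (B₀ + (if d₀ then unitVec M 0 else 0) + (if d₁ then unitVec M 1 else 0)) i j
      = emb n M TT B₀ (i + if d₀ then (n : ℤ) else 0) (j + if d₁ then (n : ℤ) else 0) := by
  cases d₀ <;> cases d₁ <;> simp [emb_TT_add_unitVec]

omit [DecidablePred S] in
/-- **LOCATION**: for `n ≥ 64`, every site is `emb TT b (m₀ + q·k₀) (m₁ + q·k₁)` with `k_ν ≤ 3` and `2·tIdx m_ν ≤ q + 6` (`q = ⌊n/4⌋`). [folklore] -/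
theorem locate (hn : 64 ≤ n) (x : Tor (fine n M)) :
    ∃ (b : Tor M) (k₀ k₁ : ℕ) (m₀ m₁ : ℤ), k₀ ≤ 3 ∧ k₁ ≤ 3 ∧ 2 * tIdx m₀ ≤ (n / 4 : ℕ) + 6 ∧ 2 * tIdx m₁ ≤ (n / 4 : ℕ) + 6
      ∧ x = emb n M TT b (m₀ + ((n / 4 : ℕ) : ℤ) * k₀) (m₁ + ((n / 4 : ℕ) : ℤ) * k₁) := by
  obtain ⟨-, -, -, -, -, h4q, hq4⟩ := census_arith n hn
  set q : ℕ := n / 4 with hq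
  have hq1 : 1 ≤ q := by omega
  have hq5 : 5 ≤ q := by omega
  set B₀ := blockOf n M x
  set o : Fin 2 → ℕ := fun ν => (x ν).val % n with ho
  have hon : ∀ ν, o ν < n := fun ν => Nat.mod_lt _ (Nat.pos_of_ne_zero (NeZero.ne n))
  have hx0 : emb n M TT B₀ ((o 0 : ℕ) : ℤ) ((o 1 : ℕ) : ℤ) = x := emb_TT_blockOf n M x
  -- rounding per axis
  set kk : Fin 2 → ℕ := fun ν => rnd q (o ν) with hkk
  have hkk4 : ∀ ν, kk ν ≤ 4 := fun ν => rnd_le_four hq5 (by have := hon ν; omega)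
  set d : Fin 2 → Bool := fun ν => decide (kk ν = 4) with hd
  set k : Fin 2 → ℕ := fun ν => if kk ν = 4 then 0 else kk ν with hk
  set m : Fin 2 → ℤ := fun ν => if kk ν = 4 then ((o ν : ℕ) : ℤ) - n else ((o ν : ℕ) : ℤ) - q * kk ν with hm
  have hk3 : ∀ ν, k ν ≤ 3 := by
    intro ν; simp only [hk]; split_ifs with h
    · omega
    · have := hkk4 ν; omega
  have htm : ∀ ν, 2 * tIdx (m ν) ≤ (q : ℤ) + 6 := by
    intro ν; simp only [hm]; split_ifs with h
    · exact tIdx_sub_n_le hq1 hq4 h4q (hon ν) h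
    · exact (tIdx_sub_rnd_le hq1 (o ν)).trans (by omega)
  have hsum : ∀ ν, m ν + (q : ℤ) * k ν + (if d ν then (n : ℤ) else 0) = ((o ν : ℕ) : ℤ) := by
    intro ν; simp only [hm, hk, hd]
    by_cases h : kk ν = 4
    · simp [h]
    · simp [h]
  refine ⟨B₀ + (if d 0 then unitVec M 0 else 0) + (if d 1 then unitVec M 1 else 0), k 0, k 1, m 0, m 1, hk3 0, hk3 1, htm 0, htm 1, ?_⟩
  rw [emb_TT_shift, hsum 0, hsum 1, hx0]

/-! ## §3 The pointwise domination -/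

omit hM [DecidablePred S] in
/-- an `Ω`-site in the corner window of `b` that is not an isolated piece position has an axis-neighbour block in `S`. [folklore] -/
theorem nbr_of_not_isolated {b : Tor M} {a y : Bool} (hay : S (starBlk M TT b ![a, y])) (hiso : ¬ IsolatedAt M S TT b a y) :
    S (starBlk M TT b ![!a, y]) ∨ S (starBlk M TT b ![a, !y]) := by
  by_contra h
  push Not at h
  apply hiso
  refine ⟨fun p h0 h1 => ?_, fun p h0 h1 => ?_, fun p h0 h1 => ?_⟩
  · rw [pat_eq p, h0, h1]; exact hay
  · rw [pat_eq p, h1, show p 0 = !a by cases hp : p 0 <;> cases ha : a <;> simp_all]; exact h.1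
  · rw [pat_eq p, h0, show p 1 = !y by cases hp : p 1 <;> cases hy : y <;> simp_all]; exact h.2

/-- **THE POINTWISE DOMINATION ON `Ω`**: for `n ≥ 64`, `q + 6 ≤ 2^{J+4}`, a family `V` containing every re-entrant vertex, and a
weight `g` with `0 ≤ g ≤ g_max` and `g(emb σ b i j) ≤ C_g·ρ(i,j)/n` off the quadrant of every `(σ, b) ∈ V` (`ρ ≤ 2^{J+3}`), `0 ≤ C_g`:
`g(x) ≤ C_g·W_H(x) + g_max·(W_P(x) + W_T(x) + W_I(x))` for every `x ∈ Ω`. [folklore] -/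
theorem dom_pointwise (hn : 64 ≤ n) (V : Finset ((Fin 2 → Bool) × Tor M))
    (hVre : ∀ σ b, ReentrantAt M S σ b → (σ, b) ∈ V) {J : ℕ} (hJ : (n / 4 : ℕ) + 6 ≤ 2 * 2 ^ (J + 3))
    {g : Tor (fine n M) → ℝ} {Cg gmax : ℝ} (hCg : 0 ≤ Cg) (hg0 : ∀ x, 0 ≤ g x) (hgmax : ∀ x, g x ≤ gmax)
    (hgV : ∀ σ b, (σ, b) ∈ V → ∀ i j : ℤ, ¬ (0 ≤ i ∧ 0 ≤ j) → rho i j ≤ 2 ^ (J + 3) →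
      g (emb n M σ b i j) ≤ Cg * (rho i j : ℝ) / n)
    {x : Tor (fine n M)} (hx : blockReg n M S x) :
    g x ≤ Cg * WH n M V J x + gmax * (WP n M S x + WT n M S x + WI n M S x) := by
  obtain ⟨hK, h2P, hL1, hqP, hPq, h4q, hq4⟩ := census_arith n hn
  obtain ⟨b, k₀, k₁, m₀, m₁, hk₀, hk₁, hm₀, hm₁, hxe⟩ := locate n M hn x
  have hgmax0 : 0 ≤ gmax := (hg0 x).trans (hgmax x)
  have hWP := WP_nonneg n M S x
  have hWT := WT_nonneg n M S x
  have hWI := WI_nonneg n M S x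
  have hWH := WH_nonneg n M V J x
  have hsplit : gmax * (WP n M S x + WT n M S x + WI n M S x) = gmax * WP n M S x + gmax * WT n M S x + gmax * WI n M S x := by ring
  have ht0 := one_le_tIdx m₀
  have ht1 := one_le_tIdx m₁
  have hmP₀ : tIdx m₀ ≤ (Pn n : ℕ) := by omega
  have hmP₁ : tIdx m₁ ≤ (Pn n : ℕ) := by omega
  have hmb₀ : -(Pn n : ℤ) ≤ m₀ ∧ m₀ < Pn n := by unfold tIdx at hmP₀; split_ifs at hmP₀ <;> constructor <;> omega
  have hmb₁ : -(Pn n : ℤ) ≤ m₁ ∧ m₁ < Pn n := by unfold tIdx at hmP₁; split_ifs at hmP₁ <;> constructor <;> omega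
  have hPn : Pn n ≤ n := by omega
  -- the window indices of `(m₀, m₁)` in `Q_P`
  obtain ⟨s, hs, hsm⟩ : ∃ s : ℕ, s < 2 * Pn n ∧ -(Pn n : ℤ) + s = m₀ := ⟨(m₀ + Pn n).toNat, by omega, by omega⟩
  obtain ⟨t, ht, htm⟩ : ∃ t : ℕ, t < 2 * Pn n ∧ -(Pn n : ℤ) + t = m₁ := ⟨(m₁ + Pn n).toNat, by omega, by omega⟩
  by_cases hk : k₀ = 0 ∧ k₁ = 0
  · -- CORNER WINDOW: `x = emb TT b m₀ m₁`
    obtain ⟨rfl, rfl⟩ := hk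
    have hxe0 : x = emb n M TT b m₀ m₁ := by rw [hxe]; simp
    have hay : S (starBlk M TT b ![decide (0 ≤ m₀), decide (0 ≤ m₁)]) :=
      (blockReg_emb_TT_iff n M (S := S) (b := b) (by omega) (by omega) (by omega) (by omega)).mp (hxe0 ▸ hx)
    by_cases hprod : IsProdAt M S b
    · -- product star: the corner window of `b` is in `W_P`
      have hwin : WprodT (Awin M S b 0 0) (Bwin M S b 0 0) 0 0 m₀ m₁ :=
        (hW_corner n M (S := S) hprod hPn m₀ m₁ hmP₀ hmP₁).mp (by rw [add_zero, add_zero, ← hxe0]; exact hx)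
      have hind : indW (WprodT (Awin M S b 0 0) (Bwin M S b 0 0) 0 0) (-(Pn n : ℤ) + s) (-(Pn n : ℤ) + t) = 1 := by
        rw [indW, if_pos]; rw [hsm, htm]; exact hwin
      have h1 : (1 : ℝ) ≤ plainWT n M (TT, b) (Awin M S b 0 0) (Bwin M S b 0 0) 0 0 (Pn n) x := by
        rw [← hind]
        exact le_plainWT n M (TT, b) _ _ 0 0 (Pn n) hs ht (by rw [add_zero, add_zero, hsm, htm]; exact hxe0)
      have h2 := plainWT_le_WP n M S hprod x
      calc g x ≤ gmax := hgmax x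
        _ ≤ gmax * WP n M S x := le_mul_of_one_le_right hgmax0 (h1.trans h2)
        _ ≤ _ := by rw [hsplit]; linarith [mul_nonneg hCg hWH, mul_nonneg hgmax0 hWT, mul_nonneg hgmax0 hWI]
    · set ay : Bool × Bool := (decide (0 ≤ m₀), decide (0 ≤ m₁)) with hay_def
      by_cases hiso : IsolatedAt M S TT b ay.1 ay.2
      · -- isolated piece: the piece of `b` at the position of `x` is in `W_I`
        have hwin : Quad ay.1 ay.2 m₀ m₁ := ⟨rfl, rfl⟩
        have hind : indW (Quad ay.1 ay.2) (-(Pn n : ℤ) + s) (-(Pn n : ℤ) + t) = 1 := by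
          rw [indW, if_pos]; rw [hsm, htm]; exact hwin
        have h1 : (1 : ℝ) ≤ pieceW n M (TT, b) ay.1 ay.2 (Pn n) x := by
          rw [← hind]
          exact le_pieceW n M (TT, b) _ _ (Pn n) hs ht (by rw [hsm, htm]; exact hxe0)
        have h2 := pieceW_le_WI n M S b hiso x
        calc g x ≤ gmax := hgmax x
          _ ≤ gmax * WI n M S x := le_mul_of_one_le_right hgmax0 (h1.trans h2)
          _ ≤ _ := by rw [hsplit]; linarith [mul_nonneg hCg hWH, mul_nonneg hgmax0 hWT, mul_nonneg hgmax0 hWP]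
      · -- re-entrant: `(σ, b) ∈ V` and `x` is an off-quadrant site of its dyadic neighbourhood
        obtain ⟨σ, hre⟩ := exists_reentrant M b hay hprod (nbr_of_not_isolated M S hay hiso)
        have hv : (σ, b) ∈ V := hVre σ b hre
        have hxσ : x = emb n M σ b (crd σ 0 m₀) (crd σ 1 m₁) := by rw [hxe0, ← emb_crd n M σ b m₀ m₁]
        have hρ : rho (crd σ 0 m₀) (crd σ 1 m₁) = rho m₀ m₁ := by unfold rho; rw [tIdx_crd, tIdx_crd]
        have hρJ : rho m₀ m₁ ≤ 2 ^ (J + 3) := by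
          have : (((n / 4 : ℕ) : ℤ)) + 6 ≤ 2 * 2 ^ (J + 3) := by exact_mod_cast hJ
          unfold rho; exact max_le (by omega) (by omega)
        have hoff : ¬ (0 ≤ crd σ 0 m₀ ∧ 0 ≤ crd σ 1 m₁) := by
          rintro ⟨h0, h1⟩
          rw [crd_nonneg_iff] at h0 h1
          have hσ : (![decide (0 ≤ m₀), decide (0 ≤ m₁)] : Fin 2 → Bool) = σ := by rw [pat_eq σ, ← h0, ← h1]
          rw [hσ] at hay
          exact ((reentrantAt_iff_TT M σ b).mp hre).1 hay
        have hg1 : g x ≤ Cg * (rho (crd σ 0 m₀) (crd σ 1 m₁) : ℝ) / n := by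
          rw [hxσ]; exact hgV σ b hv _ _ hoff (by rw [hρ]; exact hρJ)
        -- the window `Q_{n−1}` indices of `(crd σ 0 m₀, crd σ 1 m₁)`
        have hc₀ : -((n - 1 : ℕ) : ℤ) ≤ crd σ 0 m₀ ∧ crd σ 0 m₀ < (n - 1 : ℕ) := by
          have : ((n - 1 : ℕ) : ℤ) = n - 1 := by omega
          rw [this]; unfold crd; split_ifs <;> constructor <;> omega
        have hc₁ : -((n - 1 : ℕ) : ℤ) ≤ crd σ 1 m₁ ∧ crd σ 1 m₁ < (n - 1 : ℕ) := by
          have : ((n - 1 : ℕ) : ℤ) = n - 1 := by omega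
          rw [this]; unfold crd; split_ifs <;> constructor <;> omega
        obtain ⟨s', hs', hsi⟩ : ∃ s' : ℕ, s' < 2 * (n - 1) ∧ -((n - 1 : ℕ) : ℤ) + s' = crd σ 0 m₀ :=
          ⟨(crd σ 0 m₀ + (n - 1 : ℕ)).toNat, by omega, by omega⟩
        obtain ⟨t', ht', htj⟩ : ∃ t' : ℕ, t' < 2 * (n - 1) ∧ -((n - 1 : ℕ) : ℤ) + t' = crd σ 1 m₁ :=
          ⟨(crd σ 1 m₁ + (n - 1 : ℕ)).toNat, by omega, by omega⟩
        have hval : offQ (-((n - 1 : ℕ) : ℤ) + s') (-((n - 1 : ℕ) : ℤ) + t') * wJ J (-((n - 1 : ℕ) : ℤ) + s') (-((n - 1 : ℕ) : ℤ) + t')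
            / (n : ℝ) = (rho (crd σ 0 m₀) (crd σ 1 m₁) : ℝ) / n := by
          rw [hsi, htj, offQ, if_neg hoff, wJ, if_pos (by rw [hρ]; exact hρJ), one_mul]
        have h1 : (rho (crd σ 0 m₀) (crd σ 1 m₁) : ℝ) / n ≤ hessW n M (σ, b) (n - 1) J x := by
          rw [← hval]; exact le_hessW n M (σ, b) (n - 1) J hs' ht' (by rw [hsi, htj]; exact hxσ)
        have h2 := hessW_le_WH n M hv J x
        calc g x ≤ Cg * (rho (crd σ 0 m₀) (crd σ 1 m₁) : ℝ) / n := hg1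
          _ = Cg * ((rho (crd σ 0 m₀) (crd σ 1 m₁) : ℝ) / n) := by ring
          _ ≤ Cg * WH n M V J x := mul_le_mul_of_nonneg_left (h1.trans h2) hCg
          _ ≤ _ := by rw [hsplit]; linarith [mul_nonneg hgmax0 hWP, mul_nonneg hgmax0 hWT, mul_nonneg hgmax0 hWI]
  · -- TRANSLATED WINDOW `(b, k)`, `k ≠ 0`: it is in `W_T`
    have hkK : (k₀, k₁) ∈ Kgrid := by
      unfold Kgrid
      refine mem_erase.mpr ⟨fun h => hk ?_, mem_product.mpr ⟨mem_range.mpr (by omega), mem_range.mpr (by omega)⟩⟩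
      simp only [Prod.mk.injEq] at h
      exact h
    have hq0 : (0 : ℤ) ≤ ((n / 4 : ℕ) : ℤ) := by positivity
    have hPq' : ((Pn n : ℕ) : ℤ) + 1 ≤ ((n / 4 : ℕ) : ℤ) := by exact_mod_cast hPq
    have h4q' : 4 * ((n / 4 : ℕ) : ℤ) ≤ n := by exact_mod_cast h4q
    have hlow : ∀ k : ℕ, k ≠ 0 → ((Pn n : ℕ) : ℤ) ≤ ((n / 4 : ℕ) : ℤ) * k := fun k hk => by
      have h := mul_le_mul_of_nonneg_left (show (1 : ℤ) ≤ k by exact_mod_cast Nat.pos_of_ne_zero hk) hq0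
      linarith
    have hhigh : ∀ k : ℕ, k ≤ 3 → ((n / 4 : ℕ) : ℤ) * k + Pn n ≤ n := fun k hk => by
      have h := mul_le_mul_of_nonneg_left (show (k : ℤ) ≤ 3 by exact_mod_cast hk) hq0
      linarith
    -- `hW` for this window, by cases on which index vanishes
    have hwin : WprodT (Awin M S b k₀ k₁) (Bwin M S b k₀ k₁) (((n / 4 : ℕ) : ℤ) * k₀) (((n / 4 : ℕ) : ℤ) * k₁) m₀ m₁ := by
      have hxΩ : blockReg n M S (emb n M TT b (m₀ + ((n / 4 : ℕ) : ℤ) * k₀) (m₁ + ((n / 4 : ℕ) : ℤ) * k₁)) := by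
        rw [← hxe]; exact hx
      by_cases h0 : k₀ = 0
      · subst h0
        have h1 : k₁ ≠ 0 := fun h1 => hk ⟨rfl, h1⟩
        have e0 : ((n / 4 : ℕ) : ℤ) * ((0 : ℕ) : ℤ) = 0 := by simp
        rw [e0] at hxΩ ⊢
        exact (hW_fst n M (S := S) (b := b) h1 hPn (hlow k₁ h1) (hhigh k₁ hk₁) m₀ m₁ hmP₀ hmP₁).mp hxΩ
      · by_cases h1 : k₁ = 0
        · subst h1
          have e1 : ((n / 4 : ℕ) : ℤ) * ((0 : ℕ) : ℤ) = 0 := by simp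
          rw [e1] at hxΩ ⊢
          exact (hW_snd n M (S := S) (b := b) h0 hPn (hlow k₀ h0) (hhigh k₀ hk₀) m₀ m₁ hmP₀ hmP₁).mp hxΩ
        · exact (hW_both n M (S := S) (b := b) h0 h1 (hlow k₀ h0) (hhigh k₀ hk₀) (hlow k₁ h1) (hhigh k₁ hk₁) m₀ m₁ hmP₀ hmP₁).mp hxΩ
    have hind : indW (WprodT (Awin M S b k₀ k₁) (Bwin M S b k₀ k₁) (((n / 4 : ℕ) : ℤ) * k₀) (((n / 4 : ℕ) : ℤ) * k₁))
        (-(Pn n : ℤ) + s) (-(Pn n : ℤ) + t) = 1 := by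
      rw [indW, if_pos]; rw [hsm, htm]; exact hwin
    have h1 : (1 : ℝ) ≤ plainWT n M (TT, b) (Awin M S b k₀ k₁) (Bwin M S b k₀ k₁) (((n / 4 : ℕ) : ℤ) * k₀) (((n / 4 : ℕ) : ℤ) * k₁)
        (Pn n) x := by
      rw [← hind]
      exact le_plainWT n M (TT, b) _ _ _ _ (Pn n) hs ht (by rw [hsm, htm]; exact hxe)
    have h2 := plainWT_le_WT n M S b hkK x
    calc g x ≤ gmax := hgmax x
      _ ≤ gmax * WT n M S x := le_mul_of_one_le_right hgmax0 (h1.trans h2)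
      _ ≤ _ := by rw [hsplit]; linarith [mul_nonneg hCg hWH, mul_nonneg hgmax0 hWP, mul_nonneg hgmax0 hWI]

end Summit.QuantumFields.BalabanUV.Beta.GAN24.DirichletVertexDom

end
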